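/-
Copyright (c) 2026 the pub-hodgecm-mathlib formalisation cell (harness21).  Prover seat hodgecm-mathlib-K2Liu-p10 (g5), Track B «K2-LIT»,
#184♮ = hLiu418 = `stmt-HodgeConjecture-24832`; (σ) endgame organ, socket σ-10: the face's `φ₀ hφ₀ hφ₀w` (a section of `I_v(½)` non-zero at `w_Δ`).
-/
import Summits.HodgeConjecture.HodgeConjecture.Theorems.K2LiuA7ValueMap                         -- ★ `comp_mul_right_mem_localDegPS`
import Summits.HodgeConjecture.HodgeConjecture.Theorems.K2LiuA7ValueInstanceSectionMapValues   -- ★ `sectionMapLoc_apply_one` (brings ★ I-4a `sectionMapLoc`)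
import Literature.NumberTheory.GelbartRogawski1991.LocalDoubledUnitaryIwahori                      -- ★ `weylDelta`, `weylDelta_mul_self`
import Literature.NumberTheory.Automorphic.LocalPiSchwartzBruhatFourier                            -- ★ `piPrimePowBall`, `indicator_piPrimePowBall_mem_schwartzBruhat`
import HarnessLib

/-!
# Crux `HLiu418`, (σ) endgame, σ-10: THE FACE's `φ₀ hφ₀ hφ₀w` — A SECTION OF `I_v(½, χ_v)` WITH `φ₀(w_Δ) ≠ 0`

Cell `hodgecm-mathlib`, crux item hLiu418 = `stmt-HodgeConjecture-24832`, route of record `HCCMUnconditional`; squad K2 ∕ K2Liu, prover K2Liu-p10 (g5); organ lead K2Liu-p09 (g7)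
(v7 of the face takes `(φ₀) (hφ₀ : φ₀ ∈ localDegPS … (χ³)_v ½) (hφ₀w : φ₀ w_Δ ≠ 0)` BY VALUE).  THEOREMS ONLY; lane `--supports stmt-HodgeConjecture-24832 --as helper`.

* §1 (★ K2Lit generic currency) **`exists_mem_localDegPS_weylDelta_ne_zero_of_one_ne_zero`**: from any `φ ∈ I_v(s, χ_v)` with `φ(1) ≠ 0`, the right translate
  `φ₀ := φ(· w_Δ)` lies in `I_v(s, χ_v)` (★ `comp_mul_right_mem_localDegPS`) and `φ₀(w_Δ) = φ(w_Δ²) = φ(1) ≠ 0` (★ `weylDelta_mul_self`); with an equivariant family `𝒜`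
  having `(𝒜 Ψ)(1) = Ψ(0)`: **`exists_mem_localDegPS_weylDelta_ne_zero_of_apply_one`** (`Ψ :=` the unit-box indicator).
* §2 (instance of record) **`exists_phi0_of_record`**: `∃ φ₀ ∈ localDegPS (Fp L) L c … v 2 … (fun w => (χ^3).localComponent w.1) (1∕2), φ₀ (w_Δ) ≠ 0` — via ★ I-4a `sectionMapLoc`
  and ★ `sectionMapLoc_apply_one`.

HONEST LABEL: HC_CM is proved only modulo the 7 printed citations (2 remaining named inputs: hLiu418 = stmt-HodgeConjecture-24832, h413 = stmt-HodgeConjecture-24833)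
until rung 0 closes; helper, closes no item.
References: [HarrisKudlaSweet1996] §1 (1.15); [KudlaRallis1994] §1; [Kudla1994] §3.
-/

set_option autoImplicit false
set_option linter.dupNamespace false -- the mandated namespace repeats `HodgeConjecture.HodgeConjecture`

noncomputable section

open scoped Matrix TensorProduct Classical
open NumberField IsDedekindDomain Filter MeasureTheory
open Literature.RepresentationTheory.HeisenbergGroup
open Literature.NumberTheory.Automorphic Literature.NumberTheory.Automorphic.UnitaryGroup Literature.NumberTheory.GaloisRepresentations
open Literature.NumberTheory.Weil1964 Literature.RepresentationTheory.HarrisKudlaSweet1996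
open Literature.NumberTheory.GelbartRogawski1991 Literature.NumberTheory.GelbartRogawski1991.GRConstruction
open Literature.NumberTheory.GelbartRogawski1991.UnitaryDualPair
open Literature.NumberTheory.GelbartRogawski1991.UnitaryDualPair.LocalSplitting
open Literature.NumberTheory.K2Lit.SiegelDoubled Literature.NumberTheory.K2Lit.LocalSiegelDoubled
open Summit.HodgeConjecture.HodgeConjecture.Cruxes.HLiu418.K2LiuDoublingSchrodingerModelDefs
open Summit.HodgeConjecture.HodgeConjecture.Cruxes.HLiu418.K2LiuLocalSWSectionDefs
open Summit.HodgeConjecture.HodgeConjecture.Cruxes.HLiu418.K2LiuSWSectionPlaceFactorisation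
open Summit.HodgeConjecture.HodgeConjecture.Cruxes.HLiu418.K2LiuSWSectionTensorPlaceFactorisation
open Summit.HodgeConjecture.HodgeConjecture.Cruxes.HLiu418.K2LiuA7ValueMap
open Summit.HodgeConjecture.HodgeConjecture.Cruxes.HLiu418.K2LiuA7ValueInstanceSectionMap
open Summit.HodgeConjecture.HodgeConjecture.Cruxes.HLiu418.K2LiuA7ValueInstanceSectionMapValues

namespace Summit.HodgeConjecture.HodgeConjecture.Cruxes.HLiu418.K2LiuA7ValueSocketPhi0

/-! ## §1 Generic: right-translate by `w_Δ` a section non-zero at `1` -/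

section Generic

variable (F : Type) [Field F] [NumberField F] (E : Type) [Field E] [NumberField E] [Algebra F E]
  [Algebra.IsQuadraticExtension F E] (c : E ≃ₐ[F] E)
  {δ : E} (hcδ : c δ = -δ) (hδ : δ ≠ 0) {d : F} (hd : δ * δ = algebraMap F E d) (v : HeightOneSpectrum (𝓞 F)) (n : ℕ)
  {T₀ : Matrix (Fin n) (Fin n) F} (hT₀ : T₀.IsSymm) {JD : Matrix (Fin (n + n)) (Fin (n + n)) E} (hJD : JD = (gramD F n T₀).map (algebraMap F E))
  (χv : ∀ w : PlacesOver E v, (w.1.adicCompletion E)ˣ →* ℂˣ) (s : ℂ)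

include hcδ hδ hd hT₀ in
/-- **a section of `I_v(s, χ_v)` non-zero at `w_Δ`, from one non-zero at `1`**: `φ₀ := φ(· w_Δ)`, `φ₀(w_Δ) = φ(1)`.
[cite: HarrisKudlaSweet1996, §1 (1.15)] [cite: Kudla1994, §3] -/
theorem exists_mem_localDegPS_weylDelta_ne_zero_of_one_ne_zero {φ : UnitaryGroup.localPi E c (n + n) JD v → ℂ}
    (hφ : φ ∈ localDegPS F E c hcδ hδ hd v n hT₀ hJD χv s) (hφ1 : φ 1 ≠ 0) :
    ∃ φ₀ : UnitaryGroup.localPi E c (n + n) JD v → ℂ, φ₀ ∈ localDegPS F E c hcδ hδ hd v n hT₀ hJD χv s ∧ φ₀ (weylDelta F E c v n hJD) ≠ 0 :=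
  ⟨fun x => φ (x * weylDelta F E c v n hJD), comp_mul_right_mem_localDegPS F E c hcδ hδ hd v n hT₀ hJD χv hφ _, by
    show φ (weylDelta F E c v n hJD * weylDelta F E c v n hJD) ≠ 0
    rwa [weylDelta_mul_self]⟩

include hcδ hδ hd hT₀ in
/-- **… from an equivariant family `𝒜 : 𝒮(X) → I_v(s, χ_v)` with `(𝒜 Ψ)(1) = Ψ(0)`**: take `Ψ :=` the indicator of the unit box (`Ψ(0) = 1`).
[cite: KudlaRallis1994, §1] [cite: HarrisKudlaSweet1996, §1 (1.15)] -/
theorem exists_mem_localDegPS_weylDelta_ne_zero_of_apply_one {ι : Type} [Fintype ι]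
    (𝒜 : SchwartzBruhat (ι → v.adicCompletion F) →ₗ[ℂ] ↥(localDegPS F E c hcδ hδ hd v n hT₀ hJD χv s))
    (h𝒜1 : ∀ Ψ : SchwartzBruhat (ι → v.adicCompletion F),
      ((𝒜 Ψ : ↥(localDegPS F E c hcδ hδ hd v n hT₀ hJD χv s)) : UnitaryGroup.localPi E c (n + n) JD v → ℂ) 1 = (Ψ : (ι → v.adicCompletion F) → ℂ) 0) :
    ∃ φ₀ : UnitaryGroup.localPi E c (n + n) JD v → ℂ, φ₀ ∈ localDegPS F E c hcδ hδ hd v n hT₀ hJD χv s ∧ φ₀ (weylDelta F E c v n hJD) ≠ 0 := by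
  let Ψ : SchwartzBruhat (ι → v.adicCompletion F) :=
    ⟨(piPrimePowBall (v.adicCompletion F) ι 0).indicator fun _ => (1 : ℂ), indicator_piPrimePowBall_mem_schwartzBruhat 0 1⟩
  refine exists_mem_localDegPS_weylDelta_ne_zero_of_one_ne_zero F E c hcδ hδ hd v n hT₀ hJD χv s (𝒜 Ψ).2 ?_
  rw [h𝒜1]
  show ((piPrimePowBall (v.adicCompletion F) ι 0).indicator fun _ => (1 : ℂ)) 0 ≠ 0
  rw [Set.indicator_of_mem (zero_mem_piPrimePowBall (F := v.adicCompletion F) (ι := ι) 0)]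
  exact one_ne_zero

end Generic

/-! ## §2 The instance of record -/

section Record

variable (L : Type) [Field L] [NumberField L] [IsCMField L] [Algebra.IsQuadraticExtension (Fp L) L]
variable {N M : ℕ} (e : Fin N × Fin M ≃ Fin 2)
  (dV : Fin N → L) (hdV : ∀ i, IsCMField.complexConj L (dV i) = dV i) (hdV0 : ∀ i, dV i ≠ 0)
  (dW : Fin M → L) (hdW : ∀ i, IsCMField.complexConj L (dW i) = dW i) (hdW0 : ∀ i, dW i ≠ 0)
variable {M' n' : ℕ} (eW : Fin M × Fin 3 ≃ Fin M') (e' : Fin N × Fin M' ≃ Fin n')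
  (dV' : Fin 3 → L) (hdV' : ∀ k, IsCMField.complexConj L (dV' k) = dV' k) (hdV'0 : ∀ k, dV' k ≠ 0) (hM₂ : (3 : ℕ) ≠ 0)
variable (χ : HeckeCharacter L) (𝔪 : ∀ v, PlaceMeasure L v)
  (𝓕 : FinLocalFamily L e' dV hdV hdV0 (tensorFrame L dW eW dV') (tensorFrame_real L dW hdW eW dV' hdV') (tensorFrame_ne_zero L dW eW dV' hdW0 hdV'0) χ 𝔪)
  (v : HeightOneSpectrum (𝓞 (Fp L)))
  [MeasurableSpace (Fin n' → v.adicCompletion (Fp L))] [BorelSpace (Fin n' → v.adicCompletion (Fp L))]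
  (μ : Measure (Fin n' → v.adicCompletion (Fp L))) [μ.IsAddHaarMeasure]
  (Γ : SchwartzBruhat (Fin (n' + n') → v.adicCompletion (Fp L)) ≃ₗ[ℂ] SchwartzBruhat (Fin (n' + n') → v.adicCompletion (Fp L)))
  (hΓ : IsDeltaIntertwiner L e' dV hdV (tensorFrame L dW eW dV') (tensorFrame_real L dW hdW eW dV' hdV') v Γ)
  (hΓ0 : ∀ Ψ : SchwartzBruhat (Fin (n' + n') → v.adicCompletion (Fp L)),
    ((Γ Ψ : SchwartzBruhat (Fin (n' + n') → v.adicCompletion (Fp L))) : (Fin (n' + n') → v.adicCompletion (Fp L)) → ℂ) 0 =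
      diagIntegral (GRConstruction.e₂ (n := n')) μ Ψ)
  (hs₀ : (1 / 2 : ℂ) = (((3 : ℕ) : ℂ) - ((2 : ℕ) : ℂ)) / 2)

set_option maxHeartbeats 800000 in -- as ★ `sectionMapLoc_apply_one`
include hdV0 hdW0 hdV'0 hM₂ 𝓕 μ Γ hΓ hΓ0 hs₀ in
/-- **THE FACE's `φ₀ hφ₀ hφ₀w` AT THE INSTANCE OF RECORD**: a section `φ₀ ∈ I_v(½, (χ³)_v)` with `φ₀(w_Δ) ≠ 0` (the right translate by `w_Δ` of the Siegel–Weil section of the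
unit-box indicator along ★ I-4a `sectionMapLoc`). [cite: KudlaRallis1994, §1] [cite: HarrisKudlaSweet1996, §1 (1.15)] -/
theorem exists_phi0_of_record :
    ∃ φ₀ : UnitaryGroup.localPi L (IsCMField.complexConj L) (2 + 2) (hermD L e dV hdV dW hdW) v → ℂ,
      φ₀ ∈ localDegPS (Fp L) L (IsCMField.complexConj L) (complexConj_imagUnit L) (imagUnit_ne_zero L) (imagUnit_mul_self L) v 2
          (gramR_isSymm L e dV hdV dW hdW) (hermD_eq_map_gramD L e dV hdV dW hdW) (fun w : PlacesOver L v => (χ ^ 3).localComponent w.1) (1 / 2) ∧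
        φ₀ (weylDelta (Fp L) L (IsCMField.complexConj L) v 2 (hermD_eq_map_gramD L e dV hdV dW hdW)) ≠ 0 :=
  exists_mem_localDegPS_weylDelta_ne_zero_of_apply_one (Fp L) L (IsCMField.complexConj L) (complexConj_imagUnit L) (imagUnit_ne_zero L) (imagUnit_mul_self L) v 2
    (gramR_isSymm L e dV hdV dW hdW) (hermD_eq_map_gramD L e dV hdV dW hdW) (fun w : PlacesOver L v => (χ ^ 3).localComponent w.1) (1 / 2)
    (sectionMapLoc L e dV hdV hdV0 dW hdW hdW0 eW e' dV' hdV' hdV'0 hM₂ χ 𝔪 𝓕 v μ Γ hΓ hΓ0 (1 / 2) hs₀)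
    (sectionMapLoc_apply_one L e dV hdV hdV0 dW hdW hdW0 eW e' dV' hdV' hdV'0 hM₂ χ 𝔪 𝓕 v μ Γ hΓ hΓ0 (1 / 2) hs₀)

end Record

end Summit.HodgeConjecture.HodgeConjecture.Cruxes.HLiu418.K2LiuA7ValueSocketPhi0

end
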